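import Summits.ResolutionOfSingularities.ResolutionOfSingularities.Theorems.WeightedInvariantELadderTwoCentreChartAt
import Summits.ResolutionOfSingularities.ResolutionOfSingularities.Theorems.WeightedInvariantELadderTwoCentreChartZeros
import Summits.ResolutionOfSingularities.ResolutionOfSingularities.Theorems.WeightedInvariantELadderTwoMaxClosed
import HarnessLib

/-!
# E2 centre, word (G-6b) `e2CentreHom`: EVERY point of `closure (maxLocus₂)` lies in a MODEL CHART `D(t)` of a read point
# (step 1 of the local-model route to «(a″)» — no embedded associated points of `Rₙ(W)`)

Route `ResolutionOfSingularities/WeightedInvariant`, crux `Theses.WeightedInvariant.HypersurfaceCentreConstruction`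
(stmt-ResolutionOfSingularities-19897), door line `local-engine` (skeleton v3.12), E2 tier, registered stub `stub_e2_centre_h`, word (G-6b),
status `Cruxes/HypersurfaceCentreConstruction/G6B-LEMMA-H-STATUS.md`: after …E2CentreHomOfNoEmbedded the word rests on «(a″)» «`Rₙ(W)` has no
embedded associated points».  The local-model route to «(a″)» computes the associated points of `Rₙ` on MODEL CHARTS `D(t)` (res-D-pv-048 /
res-L1-s36: `Stage.exists_e2ModelChartAt`, `E2Model.associatedPrimes_quotient_subset_minimalPrimes`); its first step is that the model charts COVER
`closure (maxLocus₂) ⊇ supp Rₙ`, at EVERY point (not only the closed ones of …ELadderTwoCentreChartZeros' cover (G-1)):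
* `Stage.exists_modelChart_mem_of_mem_closure_maxLocus₂` — under the graded HOM rung, (I0)₂ and the homogeneous charts (G-0)
  `E2HomogeneousChartBody`, every `ξ ∈ closure (maxLocus₂)` lies in the basic open `D(t)` of a model chart `(a, η, t, U, w)` at a read point
  `η ∈ maxLocus₂ ∩ W a` (unit chart `a`; `t` homogeneous, `t ∉ 𝔭_a(η)`; the (S5)/(S6)/(S3) clauses of `exists_e2ModelChartAt` on `D(t)`).
Proof: a unit chart `W a ∋ ξ`; a CLOSED point `c` of `closure {ξ} ∩ W a` (Jacobson); `c ∈ closure (maxLocus₂) ⊆ singImage`; the orbit-generic point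
`η(c) ∈ maxLocus₂` with `𝔭_a(η(c)) = core 𝔭_a(c)` (cover (G-1), (C-b) `mem_maxLocus₂_of_mem_closure`); the model chart at `η(c)`; `c ∈ D(t)` because `t`
is homogeneous off the core (`mem_basicOpen_of_primeIdealOf_eq_homogeneousCore`); `ξ ∈ D(t)` by generisation.  Def-free helper
(`--supports stmt-ResolutionOfSingularities-19897`); nothing here asserts any clause or anything about resolution of singularities in characteristic `p`;
AI-written, weaker than expert review. [OURS · L1 W4.3]
-/

noncomputable section

set_option linter.dupNamespace false -- mandated namespace of this single-conjunct summit

open CategoryTheory AlgebraicGeometry TopologicalSpace IsLocalRing Topology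
open Literature.AlgebraicGeometry.Resolution
open Summit.ResolutionOfSingularities.ResolutionOfSingularities.Theorems
open Summit.ResolutionOfSingularities.ResolutionOfSingularities.Cruxes.HypersurfaceCentreConstruction.LocalEngine

namespace Summit.ResolutionOfSingularities.ResolutionOfSingularities.Theorems.ELadderOne.Stage

variable {k : Type} [Field k] (S : Stage k) {p : ℕ} (ι : (R : Type) → [CommRing R] → R → Ordinal.{0})
  (J : (R : Type) → [CommRing R] → R → ℕ → Ideal R)

/-- **Every point of `closure (maxLocus₂)` lies in a model chart.**  Under the graded HOM rung, (I0)₂ and (G-0) `E2HomogeneousChartBody`, for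
`ξ ∈ closure (maxLocus₂)` there are a unit chart `a`, a read point `η ∈ maxLocus₂ ∩ W a` and a model chart `(δ, t, N, U, w)` at `η` (the package of
`exists_e2ModelChartAt`: `t ∈ piece a δ`, `t ∉ 𝔭_a(η)`, `N ≤ 3`, positive weights, homogeneous `U i`, (S5) J-presentation, (S6) zero set, (S3) cotangent
independence on `D(t)`) with `ξ ∈ D(t)`. [folklore] -/
theorem exists_modelChart_mem_of_mem_closure_maxLocus₂ [CharP k p] [PerfectField k] (hr : PRungGrHomLE 3 p ι J) (h0 : S.InvDim₂)
    (hG0 : E2HomogeneousChartBody p ι J) {ξ : S.Y} (hξ : ξ ∈ closure (S.maxLocus₂ ι)) :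
    ∃ (a : S.atlas.ι) (_ : S.IsUnitChart a) (η : S.Y) (hηa : η ∈ (S.atlas.W a : S.Y.Opens)) (_ : η ∈ S.maxLocus₂ ι),
    letI := S.atlas.gradedRing a
    ∃ (δ : Fin S.j → ℤ) (t : Γ(S.Y, S.atlas.W a)) (N : ℕ) (U : Fin N → Γ(S.Y, S.atlas.W a)) (w : Fin N → ℕ),
      ξ ∈ S.Y.basicOpen t ∧
      t ∈ S.atlas.piece a δ ∧ t ∉ ((S.atlas.W a).2.primeIdealOf ⟨η, hηa⟩).asIdeal ∧ N ≤ 3 ∧ (∀ i, 0 < w i) ∧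
      (∀ i, SetLike.IsHomogeneousElem (S.atlas.piece a) (U i)) ∧
      (∀ (y : S.Y) (hy : y ∈ S.Y.basicOpen t), ringKrullDim (S.Y.presheaf.stalk y) ≤ ((3 : ℕ) : WithBot ℕ∞) →
        (∀ i, (S.Y.presheaf.germ (S.atlas.W a) y (S.Y.basicOpen_le t hy)).hom (U i) ∈ maximalIdeal (S.Y.presheaf.stalk y)) →
        ∀ m : ℕ, J (S.Y.presheaf.stalk y) (localGenerator S.i.ker y) m =
          (weightedMonomialIdeal U w m).map (S.Y.presheaf.germ (S.atlas.W a) y (S.Y.basicOpen_le t hy)).hom) ∧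
      (∀ (y : S.Y) (hy : y ∈ S.Y.basicOpen t), ringKrullDim (S.Y.presheaf.stalk y) ≤ ((3 : ℕ) : WithBot ℕ∞) →
        ((∀ i, (S.Y.presheaf.germ (S.atlas.W a) y (S.Y.basicOpen_le t hy)).hom (U i) ∈ maximalIdeal (S.Y.presheaf.stalk y)) ↔
          (y ∈ singImage S.i.ker ∧ iotaAt ι S.i.ker y = S.mu₂ ι))) ∧
      (∀ (y : S.Y) (hy : y ∈ S.Y.basicOpen t)
        (hU : ∀ i, (S.Y.presheaf.germ (S.atlas.W a) y (S.Y.basicOpen_le t hy)).hom (U i) ∈ maximalIdeal (S.Y.presheaf.stalk y)),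
        LinearIndependent (ResidueField (S.Y.presheaf.stalk y))
          (fun i => (maximalIdeal (S.Y.presheaf.stalk y)).toCotangent ⟨_, hU i⟩)) := by
  classical
  haveI : JacobsonSpace S.Y := LocallyOfFiniteType.jacobsonSpace S.f
  -- a unit chart through `ξ` (`ξ ∈ singImage ⊆ range i`)
  have hξsing : ξ ∈ singImage S.i.ker := S.closure_maxLocus₂_subset_singImage ι hξ
  obtain ⟨x₀, hx₀⟩ := S.mem_range_of_mem_singImage hξsing
  obtain ⟨a, hx₀a, ha⟩ := S.exists_isUnitChart x₀
  have hξa : ξ ∈ (S.atlas.W a : S.Y.Opens) := hx₀ ▸ hx₀a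
  letI := S.atlas.gradedRing a
  -- a closed point `c` of `closure {ξ} ∩ W a`
  obtain ⟨c, ⟨hca, hcξ⟩, hcc⟩ := nonempty_inter_closedPoints (X := S.Y) (Z := (S.atlas.W a : Set S.Y) ∩ closure {ξ})
    ⟨ξ, hξa, subset_closure rfl⟩ ((S.atlas.W a : S.Y.Opens).2.isLocallyClosed.inter isClosed_closure.isLocallyClosed)
  rw [mem_closedPoints_iff] at hcc
  have hξc : ξ ⤳ c := specializes_iff_mem_closure.mpr hcξ
  have hcM : c ∈ closure (S.maxLocus₂ ι) := hξc.mem_closed isClosed_closure hξ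
  have hcsing : c ∈ singImage S.i.ker := S.closure_maxLocus₂_subset_singImage ι hcM
  obtain ⟨x, hx⟩ := S.mem_range_of_mem_singImage hcsing
  subst hx
  -- the read point `η(c)` over `c` (cover (G-1) with (C-b))
  obtain ⟨η, hηa, hηM, hcore⟩ := S.exists_mem_maxLocus₂_primeIdealOf_eq_homogeneousCore ι h0
    (fun y hy hcl => S.mem_maxLocus₂_of_mem_closure ι J hr h0 hy hcl) ha hca hcc hcM
  -- the model chart at `η`
  obtain ⟨δ, t, N, U, w, htδ, htη, hN, hw, hUh, hS5, hS6, hS3⟩ := S.exists_e2ModelChartAt ι J hr hG0 hηM ha hηa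
  have hct : S.i.base x ∈ S.Y.basicOpen t := S.mem_basicOpen_of_primeIdealOf_eq_homogeneousCore hca hηa hcore htδ htη
  exact ⟨a, ha, η, hηa, hηM, δ, t, N, U, w, hξc.mem_open (S.Y.basicOpen t).2 hct, htδ, htη, hN, hw, hUh, hS5, hS6, hS3⟩

end Summit.ResolutionOfSingularities.ResolutionOfSingularities.Theorems.ELadderOne.Stage

end
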